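import Summits.AtomisticToContinuum.Crystallization.Theses.ChessboardParticlePlanes
import Summits.AtomisticToContinuum.Crystallization.Theorems.ThreeConeCertificateKeplerBoundLocLimCrys
import Summits.AtomisticToContinuum.Crystallization.Theorems.HullMinimalityHullCriterionConverse

/-!
# Strategist r1 certificate: the crux `ChessboardParticlePlanes.PeriodicWindows` (stmt-AtomisticToContinuum-3240)
# is EQUIVALENT to the sub-problem `_root_.Crystallization` — by three LANDED theorems:
`PrestressSplitKorn.stub_hullCriterion` (item 3243, PeriodicWindows → IsCrystallizing),
`hullCriterionConverse_proof` (item 11780, IsCrystallizing → PeriodicWindows),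
`KeplerBoundLocalLimit.crystallization_iff_isCrystallizing` (Crystallization ↔ IsCrystallizing).
-/

open Literature.MathematicalPhysics.StatisticalMechanics

namespace Summit.AtomisticToContinuum.Crystallization.Theorems.ChessboardParticlePlanesPeriodicWindowsIffCrystallization

/-- The crux decides the sub-problem on its own (landed: hull criterion + KeplerBoundLocalLimit). [folklore] -/
theorem crystallization_of_periodicWindows
    (h : Theses.ChessboardParticlePlanes.PeriodicWindows) : _root_.Crystallization :=
  KeplerBoundLocalLimit.crystallization_iff_isCrystallizing.2
    (Theses.ChessboardParticlePlanes.HullCriterion_holds h)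

/-- The sub-problem implies the crux (landed: hull-criterion converse, item 11780). [folklore] -/
theorem periodicWindows_of_crystallization
    (h : _root_.Crystallization) : Theses.ChessboardParticlePlanes.PeriodicWindows :=
  hullCriterionConverse_proof h.2

/-- **`PeriodicWindows ↔ Crystallization`**: the crux is the sub-problem. [folklore] -/
theorem periodicWindows_iff_crystallization :
    Theses.ChessboardParticlePlanes.PeriodicWindows ↔ _root_.Crystallization :=
  ⟨crystallization_of_periodicWindows, periodicWindows_of_crystallization⟩

/-- Same for the positional conjunct alone. [folklore] -/
theorem periodicWindows_iff_isCrystallizing :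
    Theses.ChessboardParticlePlanes.PeriodicWindows ↔ IsCrystallizing lennardJones 3 :=
  ⟨Theses.ChessboardParticlePlanes.HullCriterion_holds, fun h => hullCriterionConverse_proof h⟩

#print axioms periodicWindows_iff_crystallization

end Summit.AtomisticToContinuum.Crystallization.Theorems.ChessboardParticlePlanesPeriodicWindowsIffCrystallization
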